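import Literature.ModelTheory.ExponentialFields.OMinimalDefinability
import Mathlib.Topology.Constructions
import Mathlib.Topology.Order.Basic
import Mathlib.Topology.ContinuousOn
import Mathlib.Data.Fin.Tuple.Basic
import HarnessLib

/-!
# Cells (van den Dries, Ch. 3, §2): definition and first properties

Topic `Literature/ModelTheory/ExponentialFields`.  Foundations for the cell decomposition
theorem of L. van den Dries, *Tame topology and o-minimal structures* (1998), Ch. 3, §2:
the notion of an `(i₁, …, i_m)`-**cell** of `M^m` ((2.3)–(2.4)), for an `L`-structure `M` on a
linear order with a topology (intended: an o-minimal structure with its order topology;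
`M^m = Fin m → M` carries the product topology), and the elementary facts (2.4)–(2.8):

* `IsCell L m ι C` — `C ⊆ M^m` is an `ι`-cell, `ι : Fin m → Bool` (`true` = "interval
  coordinate", `false` = "graph coordinate"), by recursion on `m` exactly as in (2.3): the
  unique `()`-cell is `M^0` ((2.6)); an `(ι, false)`-cell is the graph of a definable function
  continuous on an `ι`-cell `X`; an `(ι, true)`-cell is the band `(f, g)_X` between definable
  functions `f < g` continuous on `X`, each possibly `-∞` / `+∞` (encoded by `Option`);
* `IsCell.definable` — cells are definable sets; `IsCell.image_init` — the projection of a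
  cell of `M^{m+1}` onto `M^m` is its base cell ((2.8)); `IsCell.nonempty`;
* `IsCell.isOpen` — `(1, …, 1)`-cells are open ((2.4)); `isCell_box` — boxes are open cells;
* `IsCell.exists_injOn` — (2.7) in the weak form that suffices for the cell decomposition
  theorem: an `ι`-cell of `M^m` is mapped injectively, by a continuous map with definable
  coordinates (the projection `p_ι` onto the interval coordinates), into `M^k`, `k ≤ m`, with
  `k < m` unless the cell is open.

Nothing here is a named fact.

## References

* [Dries1998] L. van den Dries, *Tame topology and o-minimal structures*, London Math. Soc.
  Lecture Note Series 248, CUP 1998, Ch. 3, §2, (2.2)–(2.8).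
-/

open Set FirstOrder FirstOrder.Language

namespace Literature.ModelTheory.ExponentialFields

universe u v

variable {L : Language.{u, v}} {M : Type*} [L.Structure M] [LinearOrder M] [TopologicalSpace M]

/-! ### Cells -/

variable (L) in
/-- **Cells** (van den Dries 1998, Ch. 3, (2.3), with the convention (2.6) that `M^0` is the
unique `()`-cell): `IsCell L m ι C` says that `C ⊆ M^m` is an `ι`-cell, `ι : Fin m → Bool`
recording for each coordinate whether it is an "interval" (`true`, vdD's `1`) or a "graph"
(`false`, vdD's `0`) coordinate.  An `(ι, false)`-cell of `M^{m+1}` is the graph `Γ(f)` of a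
definable function `f` continuous on an `ι`-cell `X ⊆ M^m`; an `(ι, true)`-cell is a band
`(f, g)_X = {(x, r) : x ∈ X, f(x) < r < g(x)}` with `f < g` definable and continuous on `X`,
where `f` may be `-∞` and `g` may be `+∞` (`none`). [cite: Dries1998, Ch. 3 (2.3)] -/
def IsCell : (m : ℕ) → (Fin m → Bool) → Set (Fin m → M) → Prop
  | 0, _, C => C = univ
  | m + 1, ι, C => ∃ X : Set (Fin m → M), IsCell m (Fin.init ι) X ∧
      ((ι (Fin.last m) = false ∧ ∃ f : (Fin m → M) → M,
          (univ : Set M).DefinableFun L f ∧ ContinuousOn f X ∧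
          C = {v | (Fin.init v : Fin m → M) ∈ X ∧ v (Fin.last m) = f (Fin.init v)}) ∨
       (ι (Fin.last m) = true ∧ ∃ f g : Option ((Fin m → M) → M),
          (∀ f' ∈ f, (univ : Set M).DefinableFun L f' ∧ ContinuousOn f' X) ∧
          (∀ g' ∈ g, (univ : Set M).DefinableFun L g' ∧ ContinuousOn g' X) ∧
          (∀ f' ∈ f, ∀ g' ∈ g, ∀ x ∈ X, f' x < g' x) ∧
          C = {v | (Fin.init v : Fin m → M) ∈ X ∧ (∀ f' ∈ f, f' (Fin.init v) < v (Fin.last m)) ∧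
            ∀ g' ∈ g, v (Fin.last m) < g' (Fin.init v)}))

/-- Unfolding `IsCell` in dimension `0` ((2.6): `M^0` is the only `()`-cell). [cite: Dries1998, Ch. 3 (2.6)] -/
theorem isCell_zero_iff {ι : Fin 0 → Bool} {C : Set (Fin 0 → M)} : IsCell L 0 ι C ↔ C = univ :=
  Iff.rfl

/-- Unfolding `IsCell` in dimension `m + 1` ((2.3)(ii)). [cite: Dries1998, Ch. 3 (2.3)] -/
theorem isCell_succ_iff {m : ℕ} {ι : Fin (m + 1) → Bool} {C : Set (Fin (m + 1) → M)} :
    IsCell L (m + 1) ι C ↔ ∃ X : Set (Fin m → M), IsCell L m (Fin.init ι) X ∧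
      ((ι (Fin.last m) = false ∧ ∃ f : (Fin m → M) → M,
          (univ : Set M).DefinableFun L f ∧ ContinuousOn f X ∧
          C = {v | (Fin.init v : Fin m → M) ∈ X ∧ v (Fin.last m) = f (Fin.init v)}) ∨
       (ι (Fin.last m) = true ∧ ∃ f g : Option ((Fin m → M) → M),
          (∀ f' ∈ f, (univ : Set M).DefinableFun L f' ∧ ContinuousOn f' X) ∧
          (∀ g' ∈ g, (univ : Set M).DefinableFun L g' ∧ ContinuousOn g' X) ∧
          (∀ f' ∈ f, ∀ g' ∈ g, ∀ x ∈ X, f' x < g' x) ∧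
          C = {v | (Fin.init v : Fin m → M) ∈ X ∧ (∀ f' ∈ f, f' (Fin.init v) < v (Fin.last m)) ∧
            ∀ g' ∈ g, v (Fin.last m) < g' (Fin.init v)})) :=
  Iff.rfl

/-- **Graph cells** ((2.3)(ii), first clause): the graph of a definable function continuous on
an `ι`-cell is an `(ι, false)`-cell. [cite: Dries1998, Ch. 3 (2.3)] -/
theorem IsCell.graph {m : ℕ} {ι : Fin m → Bool} {X : Set (Fin m → M)} (hX : IsCell L m ι X)
    {f : (Fin m → M) → M} (hf : (univ : Set M).DefinableFun L f) (hfc : ContinuousOn f X) :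
    IsCell L (m + 1) (Fin.snoc ι false)
      {v | (Fin.init v : Fin m → M) ∈ X ∧ v (Fin.last m) = f (Fin.init v)} :=
  ⟨X, by rwa [Fin.init_snoc], Or.inl ⟨by simp, f, hf, hfc, rfl⟩⟩

/-- **Band cells** ((2.3)(ii), second clause): the band `(f, g)_X` between definable functions
`f < g` continuous on an `ι`-cell `X` (`f = -∞`, `g = +∞` allowed, as `none`) is an
`(ι, true)`-cell. [cite: Dries1998, Ch. 3 (2.3)] -/
theorem IsCell.band {m : ℕ} {ι : Fin m → Bool} {X : Set (Fin m → M)} (hX : IsCell L m ι X)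
    {f g : Option ((Fin m → M) → M)}
    (hf : ∀ f' ∈ f, (univ : Set M).DefinableFun L f' ∧ ContinuousOn f' X)
    (hg : ∀ g' ∈ g, (univ : Set M).DefinableFun L g' ∧ ContinuousOn g' X)
    (hfg : ∀ f' ∈ f, ∀ g' ∈ g, ∀ x ∈ X, f' x < g' x) :
    IsCell L (m + 1) (Fin.snoc ι true)
      {v | (Fin.init v : Fin m → M) ∈ X ∧ (∀ f' ∈ f, f' (Fin.init v) < v (Fin.last m)) ∧
        ∀ g' ∈ g, v (Fin.last m) < g' (Fin.init v)} :=
  ⟨X, by rwa [Fin.init_snoc], Or.inr ⟨by simp, f, g, hf, hg, hfg, rfl⟩⟩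

/-! ### Cells are definable -/

omit [LinearOrder M] [TopologicalSpace M] in
/-- Pulling a definable subset of `M^m` back along `Fin.init : M^{m+1} → M^m` gives a definable
set. [folklore] -/
theorem definable_setOf_init_mem {m : ℕ} {X : Set (Fin m → M)}
    (hX : (univ : Set M).Definable L X) :
    (univ : Set M).Definable L {v : Fin (m + 1) → M | (Fin.init v : Fin m → M) ∈ X} :=
  hX.preimage_comp Fin.castSucc

omit [LinearOrder M] [TopologicalSpace M] in
/-- A definable function of `M^m`, read through `Fin.init`, is a definable function of
`M^{m+1}`. [folklore] -/
theorem definableFun_comp_init {m : ℕ} {f : (Fin m → M) → M}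
    (hf : (univ : Set M).DefinableFun L f) :
    (univ : Set M).DefinableFun L (fun v : Fin (m + 1) → M => f (Fin.init v)) :=
  hf.comp fun i => definableFun_proj (Fin.castSucc i)

omit [TopologicalSpace M] in
/-- The band condition is definable (given `<` definable). [folklore] -/
theorem definable_setOf_band (hlt : (univ : Set M).Definable L {v : Fin 2 → M | v 0 < v 1})
    {m : ℕ} {X : Set (Fin m → M)} (hX : (univ : Set M).Definable L X)
    {f g : Option ((Fin m → M) → M)}
    (hf : ∀ f' ∈ f, (univ : Set M).DefinableFun L f') (hg : ∀ g' ∈ g, (univ : Set M).DefinableFun L g') :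
    (univ : Set M).Definable L {v : Fin (m + 1) → M | (Fin.init v : Fin m → M) ∈ X ∧
      (∀ f' ∈ f, f' (Fin.init v) < v (Fin.last m)) ∧ ∀ g' ∈ g, v (Fin.last m) < g' (Fin.init v)} := by
  have h₁ : (univ : Set M).Definable L
      {v : Fin (m + 1) → M | ∀ f' ∈ f, f' (Fin.init v) < v (Fin.last m)} := by
    cases f with
    | none =>
      have : {v : Fin (m + 1) → M | ∀ f' ∈ (none : Option ((Fin m → M) → M)),
          f' (Fin.init v) < v (Fin.last m)} = univ := by
        ext v; simp
      rw [this]; exact definable_univ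
    | some f₀ =>
      have : {v : Fin (m + 1) → M | ∀ f' ∈ (some f₀ : Option ((Fin m → M) → M)),
          f' (Fin.init v) < v (Fin.last m)} = {v | f₀ (Fin.init v) < v (Fin.last m)} := by
        ext v; simp
      rw [this]
      exact definable_setOf_lt hlt (definableFun_comp_init (hf f₀ rfl)) (definableFun_proj _)
  have h₂ : (univ : Set M).Definable L
      {v : Fin (m + 1) → M | ∀ g' ∈ g, v (Fin.last m) < g' (Fin.init v)} := by
    cases g with
    | none =>
      have : {v : Fin (m + 1) → M | ∀ g' ∈ (none : Option ((Fin m → M) → M)),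
          v (Fin.last m) < g' (Fin.init v)} = univ := by
        ext v; simp
      rw [this]; exact definable_univ
    | some g₀ =>
      have : {v : Fin (m + 1) → M | ∀ g' ∈ (some g₀ : Option ((Fin m → M) → M)),
          v (Fin.last m) < g' (Fin.init v)} = {v | v (Fin.last m) < g₀ (Fin.init v)} := by
        ext v; simp
      rw [this]
      exact definable_setOf_lt hlt (definableFun_proj _) (definableFun_comp_init (hg g₀ rfl))
  exact definable_setOf_and (definable_setOf_init_mem hX) (definable_setOf_and h₁ h₂)

omit [LinearOrder M] [TopologicalSpace M] in
/-- The graph condition is definable. [folklore] -/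
theorem definable_setOf_graph {m : ℕ} {X : Set (Fin m → M)} (hX : (univ : Set M).Definable L X)
    {f : (Fin m → M) → M} (hf : (univ : Set M).DefinableFun L f) :
    (univ : Set M).Definable L
      {v : Fin (m + 1) → M | (Fin.init v : Fin m → M) ∈ X ∧ v (Fin.last m) = f (Fin.init v)} :=
  definable_setOf_and (definable_setOf_init_mem hX)
    (definable_setOf_eq' (definableFun_proj _) (definableFun_comp_init hf))

/-- **Cells are definable** (van den Dries 1998, Ch. 3, (2.3): "an `(i₁, …, i_m)`-cell is a
definable subset of `R^m`"), given that `<` is definable. [cite: Dries1998, Ch. 3 (2.3)] -/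
theorem IsCell.definable (hlt : (univ : Set M).Definable L {v : Fin 2 → M | v 0 < v 1}) :
    ∀ {m : ℕ} {ι : Fin m → Bool} {C : Set (Fin m → M)}, IsCell L m ι C →
      (univ : Set M).Definable L C
  | 0, _, C, h => by
    rw [isCell_zero_iff.1 h]
    exact definable_univ
  | m + 1, ι, C, h => by
    obtain ⟨X, hX, h⟩ := h
    have hXd := IsCell.definable hlt hX
    rcases h with ⟨-, f, hf, -, rfl⟩ | ⟨-, f, g, hf, hg, -, rfl⟩
    · exact definable_setOf_graph hXd hf
    · exact definable_setOf_band hlt hXd (fun f' h => (hf f' h).1) (fun g' h => (hg g' h).1)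

/-! ### Projection and non-emptiness -/

omit [L.Structure M] [TopologicalSpace M] in
/-- Over every point of the base there is a point of a band (dense order without endpoints,
`M` non-empty). [folklore] -/
theorem exists_mem_band [DenselyOrdered M] [NoMinOrder M] [NoMaxOrder M] [Nonempty M]
    {m : ℕ} {X : Set (Fin m → M)} {f g : Option ((Fin m → M) → M)}
    (hfg : ∀ f' ∈ f, ∀ g' ∈ g, ∀ x ∈ X, f' x < g' x) {x : Fin m → M} (hx : x ∈ X) :
    ∃ r, (∀ f' ∈ f, f' x < r) ∧ ∀ g' ∈ g, r < g' x := by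
  cases f with
  | none =>
    cases g with
    | none => exact ⟨Classical.arbitrary M, by simp, by simp⟩
    | some g₀ =>
      obtain ⟨r, hr⟩ := exists_lt (g₀ x)
      exact ⟨r, by simp, by simpa using hr⟩
  | some f₀ =>
    cases g with
    | none =>
      obtain ⟨r, hr⟩ := exists_gt (f₀ x)
      exact ⟨r, by simpa using hr, by simp⟩
    | some g₀ =>
      obtain ⟨r, hr₁, hr₂⟩ := exists_between (hfg f₀ rfl g₀ rfl x hx)
      exact ⟨r, by simpa using hr₁, by simpa using hr₂⟩

/-- **The projection of a cell is its base cell** (van den Dries 1998, Ch. 3, (2.8): "if `A` is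
a cell in `R^{m+1}` then `π(A)` is a cell in `R^m`"), in the sharper form: for the data
`X, …` of an `(ι, i)`-cell `C`, `Fin.init '' C = X` (dense order without endpoints). [cite: Dries1998, Ch. 3 (2.8)] -/
theorem IsCell.image_init [DenselyOrdered M] [NoMinOrder M] [NoMaxOrder M] [Nonempty M]
    {m : ℕ} {ι : Fin (m + 1) → Bool} {C : Set (Fin (m + 1) → M)} (h : IsCell L (m + 1) ι C) :
    IsCell L m (Fin.init ι) (Fin.init '' C) := by
  obtain ⟨X, hX, h⟩ := h
  suffices heq : Fin.init '' C = X by rwa [heq]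
  rcases h with ⟨-, f, -, -, rfl⟩ | ⟨-, f, g, -, -, hfg, rfl⟩
  · ext x
    constructor
    · rintro ⟨v, hv, rfl⟩
      exact hv.1
    · intro hx
      refine ⟨Fin.snoc x (f x), ?_, Fin.init_snoc _ _⟩
      simpa [Fin.init_snoc, Fin.snoc_last] using hx
  · ext x
    constructor
    · rintro ⟨v, hv, rfl⟩
      exact hv.1
    · intro hx
      obtain ⟨r, hr₁, hr₂⟩ := exists_mem_band hfg hx
      refine ⟨Fin.snoc x r, ?_, Fin.init_snoc _ _⟩
      simp only [mem_setOf_eq, Fin.init_snoc, Fin.snoc_last]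
      exact ⟨hx, hr₁, hr₂⟩

/-- **Cells are non-empty** (dense order without endpoints, `M` non-empty; van den Dries 1998,
Ch. 3, (2.3)–(2.6)). [cite: Dries1998, Ch. 3 (2.3)] -/
theorem IsCell.nonempty [DenselyOrdered M] [NoMinOrder M] [NoMaxOrder M] [Nonempty M] :
    ∀ {m : ℕ} {ι : Fin m → Bool} {C : Set (Fin m → M)}, IsCell L m ι C → C.Nonempty
  | 0, _, C, h => by
    rw [isCell_zero_iff.1 h]
    exact ⟨fun i => i.elim0, trivial⟩
  | m + 1, ι, C, h => by
    obtain ⟨x, hx⟩ := (h.image_init).nonempty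
    obtain ⟨v, hv, -⟩ := hx
    exact ⟨v, hv⟩

/-! ### Open cells and boxes -/

omit [L.Structure M] [LinearOrder M] in
/-- `Fin.init : M^{m+1} → M^m` is continuous. [folklore] -/
theorem continuous_init {m : ℕ} : Continuous (Fin.init : (Fin (m + 1) → M) → Fin m → M) :=
  continuous_id.finInit

omit [L.Structure M] in
/-- An open base and bounds continuous on it give an open band (order topology on `M`,
product topology on `M^{m+1}`). [folklore] -/
theorem isOpen_band [OrderTopology M] {m : ℕ} {X : Set (Fin m → M)} (hX : IsOpen X)
    {f g : Option ((Fin m → M) → M)} (hf : ∀ f' ∈ f, ContinuousOn f' X)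
    (hg : ∀ g' ∈ g, ContinuousOn g' X) :
    IsOpen {v : Fin (m + 1) → M | (Fin.init v : Fin m → M) ∈ X ∧
      (∀ f' ∈ f, f' (Fin.init v) < v (Fin.last m)) ∧ ∀ g' ∈ g, v (Fin.last m) < g' (Fin.init v)} := by
  have hU : IsOpen {v : Fin (m + 1) → M | (Fin.init v : Fin m → M) ∈ X} := hX.preimage continuous_init
  have hlast : Continuous fun v : Fin (m + 1) → M => v (Fin.last m) := continuous_apply _
  have key : ∀ φ ψ : (Fin (m + 1) → M) → M, ContinuousOn φ {v | (Fin.init v : Fin m → M) ∈ X} →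
      ContinuousOn ψ {v | (Fin.init v : Fin m → M) ∈ X} →
      IsOpen {v : Fin (m + 1) → M | (Fin.init v : Fin m → M) ∈ X ∧ φ v < ψ v} := by
    intro φ ψ hφ hψ
    have h := (hφ.prodMk hψ).isOpen_inter_preimage hU isOpen_lt_prod
    convert h using 1
    ext v
    simp only [mem_setOf_eq, mem_inter_iff, mem_preimage]
  have hin : ∀ φ : (Fin m → M) → M, ContinuousOn φ X →
      ContinuousOn (fun v : Fin (m + 1) → M => φ (Fin.init v)) {v | (Fin.init v : Fin m → M) ∈ X} :=
    fun φ hφ => hφ.comp continuous_init.continuousOn fun v hv => hv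
  have hSf : IsOpen {v : Fin (m + 1) → M | (Fin.init v : Fin m → M) ∈ X ∧
      ∀ f' ∈ f, f' (Fin.init v) < v (Fin.last m)} := by
    cases f with
    | none =>
      convert hU using 1
      ext v
      simp
    | some f₀ =>
      convert key (fun v => f₀ (Fin.init v)) (fun v => v (Fin.last m)) (hin f₀ (hf f₀ rfl))
        hlast.continuousOn using 1
      ext v
      simp
  have hSg : IsOpen {v : Fin (m + 1) → M | (Fin.init v : Fin m → M) ∈ X ∧
      ∀ g' ∈ g, v (Fin.last m) < g' (Fin.init v)} := by
    cases g with
    | none =>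
      convert hU using 1
      ext v
      simp
    | some g₀ =>
      convert key (fun v => v (Fin.last m)) (fun v => g₀ (Fin.init v)) hlast.continuousOn
        (hin g₀ (hg g₀ rfl)) using 1
      ext v
      simp
  convert hSf.inter hSg using 1
  ext v
  simp only [mem_setOf_eq, mem_inter_iff]
  tauto

/-- **Open cells are open** (van den Dries 1998, Ch. 3, (2.4): "the `(1, …, 1)`-cells are
exactly the cells which are open in their ambient space `R^m`" — the direction used), for
the order topology on `M` and the product topology on `M^m`. [cite: Dries1998, Ch. 3 (2.4)] -/
theorem IsCell.isOpen [OrderTopology M] :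
    ∀ {m : ℕ} {C : Set (Fin m → M)}, IsCell L m (fun _ => true) C → IsOpen C
  | 0, C, h => by
    rw [isCell_zero_iff.1 h]
    exact isOpen_univ
  | m + 1, C, h => by
    obtain ⟨X, hX, h⟩ := h
    have hXo : IsOpen X := IsCell.isOpen (m := m) hX
    rcases h with ⟨hlast, -⟩ | ⟨-, f, g, hf, hg, -, rfl⟩
    · exact absurd hlast (by simp)
    · exact isOpen_band hXo (fun f' h => (hf f' h).2) (fun g' h => (hg g' h).2)

/-- **Boxes are open cells** (van den Dries 1998, Ch. 3, (2.3): "note that a box in `R^m` is a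
`(1, …, 1)`-cell"): for `a < b` coordinatewise, `{v | ∀ i, a i < v i < b i}` is a
`(1, …, 1)`-cell. [cite: Dries1998, Ch. 3 (2.3)] -/
theorem isCell_box (hlt : (univ : Set M).Definable L {v : Fin 2 → M | v 0 < v 1}) :
    ∀ {m : ℕ} (a b : Fin m → M), (∀ i, a i < b i) →
      IsCell L m (fun _ => true) {v | ∀ i, a i < v i ∧ v i < b i}
  | 0, a, b, _ => by
    rw [isCell_zero_iff]
    ext v
    simp only [mem_setOf_eq, mem_univ, iff_true]
    exact fun i => i.elim0
  | m + 1, a, b, hab => by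
    have hX := isCell_box hlt (Fin.init a) (Fin.init b) fun i => hab (Fin.castSucc i)
    have h := hX.band (f := some fun _ => a (Fin.last m)) (g := some fun _ => b (Fin.last m))
      (fun f' hf' => by
        obtain rfl : f' = fun _ => a (Fin.last m) := by simpa using hf'.symm
        exact ⟨definableFun_const' _ _, continuousOn_const⟩)
      (fun g' hg' => by
        obtain rfl : g' = fun _ => b (Fin.last m) := by simpa using hg'.symm
        exact ⟨definableFun_const' _ _, continuousOn_const⟩)
      (fun f' hf' g' hg' x _ => by
        obtain rfl : f' = fun _ => a (Fin.last m) := by simpa using hf'.symm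
        obtain rfl : g' = fun _ => b (Fin.last m) := by simpa using hg'.symm
        exact hab (Fin.last m))
    have hι : (Fin.snoc (fun _ : Fin m => true) true : Fin (m + 1) → Bool) = fun _ => true := by
      funext i
      refine Fin.lastCases ?_ (fun j => ?_) i
      · simp
      · simp
    rw [hι] at h
    convert h using 1
    ext v
    simp only [mem_setOf_eq, Option.mem_def, Option.some.injEq, forall_eq']
    rw [Fin.forall_fin_succ']
    rfl

/-! ### (2.7): a cell maps injectively into `M^k` -/

/-- **(2.7), weak form**: an `ι`-cell `C ⊆ M^m` admits a continuous map `e : M^m → M^k` with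
definable coordinate functions which is injective on `C`, where `k ≤ m`, and `k < m` unless
`ι = (1, …, 1)` (van den Dries 1998, Ch. 3, (2.7): the projection `p_ι` onto the interval
coordinates "maps each `ι`-cell `A` homeomorphically onto an open cell `p_ι(A)` in `R^k`";
injectivity and continuity of `p_ι`, which is all the cell decomposition theorem uses, are
recorded here). [cite: Dries1998, Ch. 3 (2.7)] -/
theorem IsCell.exists_injOn :
    ∀ {m : ℕ} {ι : Fin m → Bool} {C : Set (Fin m → M)}, IsCell L m ι C →
      ∃ k : ℕ, k ≤ m ∧ (ι ≠ (fun _ => true) → k < m) ∧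
        ∃ e : (Fin m → M) → (Fin k → M), Continuous e ∧
          (∀ j, (univ : Set M).DefinableFun L (fun v => e v j)) ∧ Set.InjOn e C
  | 0, ι, C, _ => by
    refine ⟨0, le_rfl, fun hι => (hι (funext fun i => i.elim0)).elim, id, continuous_id,
      fun j => j.elim0, fun v _ w _ h => h⟩
  | m + 1, ι, C, h => by
    obtain ⟨X, hX, h⟩ := h
    obtain ⟨k, hkm, hk, e, he, hed, hinj⟩ := IsCell.exists_injOn hX
    rcases h with ⟨hlast, f, -, -, rfl⟩ | ⟨hlast, f, g, -, -, -, rfl⟩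
    · refine ⟨k, hkm.trans (Nat.le_succ m), fun _ => Nat.lt_succ_of_le hkm,
        fun v => e (Fin.init v), he.comp continuous_init,
        fun j => (hed j).comp fun i => definableFun_proj (Fin.castSucc i), ?_⟩
      rintro v ⟨hv, hvf⟩ w ⟨hw, hwf⟩ hvw
      have hi : Fin.init v = Fin.init w := hinj hv hw hvw
      rw [← Fin.snoc_init_self v, ← Fin.snoc_init_self w, hvf, hwf, hi]
    · have hk' : ι ≠ (fun _ => true) → k < m := by
        intro hι
        refine hk fun hinit => hι ?_
        rw [← Fin.snoc_init_self ι, hinit, hlast]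
        funext i
        refine Fin.lastCases ?_ (fun j => ?_) i
        · simp
        · simp
      refine ⟨k + 1, Nat.succ_le_succ hkm, fun hι => Nat.succ_lt_succ (hk' hι),
        fun v => Fin.snoc (e (Fin.init v)) (v (Fin.last m)),
        (he.comp continuous_init).finSnoc (continuous_apply _), fun j => ?_, ?_⟩
      · refine Fin.lastCases ?_ (fun j' => ?_) j
        · have : (fun v : Fin (m + 1) → M =>
              (Fin.snoc (e (Fin.init v)) (v (Fin.last m)) : Fin (k + 1) → M) (Fin.last k)) =
              fun v => v (Fin.last m) := funext fun v => by simp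
          rw [this]
          exact definableFun_proj _
        · have : (fun v : Fin (m + 1) → M =>
              (Fin.snoc (e (Fin.init v)) (v (Fin.last m)) : Fin (k + 1) → M) (Fin.castSucc j')) =
              fun v => e (Fin.init v) j' := funext fun v => by simp
          rw [this]
          exact (hed j').comp fun i => definableFun_proj (Fin.castSucc i)
      · rintro v ⟨hv, -⟩ w ⟨hw, -⟩ hvw
        obtain ⟨h₁, h₂⟩ := Fin.snoc_injective2 hvw
        have hi : Fin.init v = Fin.init w := hinj hv hw h₁
        rw [← Fin.snoc_init_self v, ← Fin.snoc_init_self w, hi, h₂]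

end Literature.ModelTheory.ExponentialFields
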